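import Summits.QuantumAdvantage.QuantumAdvantage.Theorems.SosSandwichOneQueryInfluence
import HarnessLib

/-!
# The `Q_T` child line of crux `PseudoBoundedAA` (stmt-QuantumAdvantage-15237), certified glue: `AA_Q ⟸ HomogeneousRung_Q ∧ LevelDescent_Q`

Route `SosSandwich` names "retreat to `Q_T`" as the pivot after a `K_T ∖ Q_T` counterexample (which appeared: the
address family of `not_HomogeneousPBAA`, `maxInf = 16·Var²/T`).  This file lands the COMPOSITION of that child line
in the kernel, in the shape of the (repaired) birth skeleton of 15237 but inside `Q_T`:

* crux **`AA_Q`** (inline; hypothesis of `QueryRestrict.quantumQuerySimulable_of_aaQuery`, weaker than PB-AA by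
  `aaQuery_of_pseudoBoundedAA`, exponent `≥ 2` forced by `MeanSquareAlg.aaQuery_exponent_ge_two`);
* stub **`HomogeneousRung_Q`** (inline hypothesis `hH`): a DEGREE-FREE rung `maxInf ≥ C_H·Var²` for top-homogeneous
  acceptance probabilities of quantum query algorithms — a THEOREM IN PRINT (Escudero Gutiérrez, arXiv:2304.06713,
  Thm 1.6 + Thm 1.4 / Cor 1.7: `C_H = 16` when `E p = 1/2`, `C_H = 4` in general, in the tree's normalisation
  `Inf^{tree}[p] = Inf^{EG}[2p−1]`, `Var^{EG}[2p−1] = 4·Var[p]`), to be typed as a Literature fact (fcb norms) — NOT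
  asserted here;
* stub **`LevelDescent_Q`** (inline hypothesis `hD`): level descent with polynomial loss INSIDE `Q_T` (surrogate = the
  acceptance probability of a query algorithm with `1 ≤ T' ≤ T` queries, either one query or top-homogeneous,
  variance `≥ A(ε/T)^a`, influences dominated) — open;
* base class `T' = 1`: a THEOREM (`oneQuery_exists_influence_ge`: `4Var² ≤ 9·maxInf` for one-query algorithms).

`aaQuery_of_homogeneousRungQ_of_levelDescentQ`: `hH → hD → AA_Q` with exponent `2a` and constant
`min(4/9, C_H)·A²/B` — no loss in `T` from the rung (degree-free on `Q_T`, unlike `K_T`).  Honest label: glue; the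
two stubs are a Literature typing job and an open problem respectively.

Sources: EscuderoGutierrez2023 (arXiv:2304.06713) Thm 1.4, Thm 1.6, Cor 1.7; AaronsonAmbainis2014 Conj. 6;
BealsEtAl2001 Lemma 4.1.
-/

noncomputable section

set_option linter.dupNamespace false

namespace Summit.QuantumAdvantage.QuantumAdvantage.Theorems.SosSandwich

open Literature.Computability.Cryptography Literature.Computability.QuantumComplexity

/-- **The `Q_T` child line composes**: a degree-free homogeneous rung on `Q_T` (hypothesis `hH`, Escudero Gutiérrez
Cor 1.7 shape) and level descent inside `Q_T` (hypothesis `hD`) give `AA_Q` with exponent `2a` and constant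
`min(4/9, C_H)·A²/B`; the one-query base class is discharged by `oneQuery_exists_influence_ge`.
[cite: EscuderoGutierrez2023, Cor. 1.7] [cite: AaronsonAmbainis2014, Conj. 6] -/
theorem aaQuery_of_homogeneousRungQ_of_levelDescentQ
    (hH : ∃ C_H : ℝ, 0 < C_H ∧ ∀ (N : ℕ) (Q : QQueryAlg N) (p : MvPolynomial (Fin N) ℝ), 1 ≤ Q.queries →
      (∀ x, evalBool p x = Q.acceptProb x) →
      (∀ x : Fin N → Bool, ∑ i : Fin N, (evalBool p x - evalBool p (Function.update x i (!x i))) =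
        4 * (Q.queries : ℝ) * (evalBool p x - boolAvg (evalBool p))) →
      0 < boolVariance p → ∃ i : Fin N, C_H * boolVariance p ^ 2 ≤ influence i p)
    (hD : ∃ (a : ℕ) (A B : ℝ), 0 < A ∧ 0 < B ∧
      ∀ (N : ℕ) (Q : QQueryAlg N) (p : MvPolynomial (Fin N) ℝ) (ε : ℝ), 1 ≤ Q.queries →
        (∀ x, evalBool p x = Q.acceptProb x) → 0 < ε → ε ≤ boolVariance p →
        ∃ (N' : ℕ) (Q' : QQueryAlg N') (q : MvPolynomial (Fin N') ℝ),
          1 ≤ Q'.queries ∧ Q'.queries ≤ Q.queries ∧ (∀ x, evalBool q x = Q'.acceptProb x) ∧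
          (Q'.queries = 1 ∨ (∀ x : Fin N' → Bool,
            ∑ i : Fin N', (evalBool q x - evalBool q (Function.update x i (!x i))) =
              4 * (Q'.queries : ℝ) * (evalBool q x - boolAvg (evalBool q)))) ∧
          A * (ε / Q.queries) ^ a ≤ boolVariance q ∧
          ∀ i : Fin N', ∃ i' : Fin N, influence i q ≤ B * influence i' p) :
    ∃ (c : ℕ) (C : ℝ), 0 < C ∧ ∀ (N : ℕ) (Q : QQueryAlg N) (p : MvPolynomial (Fin N) ℝ) (ε : ℝ),
      1 ≤ Q.queries → (∀ x, evalBool p x = Q.acceptProb x) → 0 < ε → ε ≤ boolVariance p →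
        ∃ i : Fin N, C * (ε / Q.queries) ^ c ≤ influence i p := by
  obtain ⟨C_H, hCH, hHb⟩ := hH
  obtain ⟨a, A, B, hA, hB, hDb⟩ := hD
  set K : ℝ := min (4 / 9) C_H * A ^ 2 / B with hK
  refine ⟨2 * a, K, by positivity, fun N Q p ε hT hp hε hv => ?_⟩
  obtain ⟨N', Q', q, hT'1, -, hq, hbase, hvar, hdom⟩ := hDb N Q p ε hT hp hε hv
  set s : ℝ := ε / Q.queries with hs
  have hs0 : 0 < s := div_pos hε (by exact_mod_cast hT)
  have hAs : 0 < A * s ^ a := by positivity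
  have hvq : 0 < boolVariance q := lt_of_lt_of_le hAs hvar
  have hm0 : 0 ≤ min (4 / 9 : ℝ) C_H := le_min (by norm_num) hCH.le
  -- an influential variable of the surrogate: `min(4/9, C_H)·Var[q]² ≤ Inf_i[q]`
  have key : ∃ i : Fin N', min (4 / 9 : ℝ) C_H * boolVariance q ^ 2 ≤ influence i q := by
    rcases hbase with h1 | hhom
    · obtain ⟨i, hi⟩ := oneQuery_exists_influence_ge Q' h1 q hq hvq
      refine ⟨i, ?_⟩
      calc min (4 / 9 : ℝ) C_H * boolVariance q ^ 2 ≤ 4 / 9 * boolVariance q ^ 2 :=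
            mul_le_mul_of_nonneg_right (min_le_left _ _) (sq_nonneg _)
        _ ≤ influence i q := by linarith
    · obtain ⟨i, hi⟩ := hHb N' Q' q hT'1 hq hhom hvq
      refine ⟨i, le_trans ?_ hi⟩
      exact mul_le_mul_of_nonneg_right (min_le_right _ _) (sq_nonneg _)
  obtain ⟨i, hi⟩ := key
  obtain ⟨i', hi'⟩ := hdom i
  refine ⟨i', ?_⟩
  have hsq : (A * s ^ a) ^ 2 ≤ boolVariance q ^ 2 := pow_le_pow_left₀ hAs.le hvar 2
  have hchain : min (4 / 9 : ℝ) C_H * A ^ 2 * s ^ (2 * a) ≤ B * influence i' p :=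
    calc min (4 / 9 : ℝ) C_H * A ^ 2 * s ^ (2 * a) = min (4 / 9 : ℝ) C_H * (A * s ^ a) ^ 2 := by
          rw [pow_mul']; ring
      _ ≤ min (4 / 9 : ℝ) C_H * boolVariance q ^ 2 := mul_le_mul_of_nonneg_left hsq hm0
      _ ≤ influence i q := hi
      _ ≤ B * influence i' p := hi'
  have hrew : K * s ^ (2 * a) = (min (4 / 9 : ℝ) C_H * A ^ 2 * s ^ (2 * a)) / B := by rw [hK]; ring
  rw [hrew, div_le_iff₀ hB]
  linarith [mul_comm B (influence i' p)]

end Summit.QuantumAdvantage.QuantumAdvantage.Theorems.SosSandwich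

end
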